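import Summits.BirchSwinnertonDyer.Rank1Residual.X2.SplitCellCClassIntEtale
import Summits.BirchSwinnertonDyer.Rank1Residual.X2.NonsplitCellCClassIntPNew
import HarnessLib

/-!
# O9 ∩ {SPLIT} at `p ≥ 5`, CLASS LEVEL: the value half c2s DISCHARGED from print — [cas-split]
# Thms. 2.10–2.11 in BDP 2013's display (`thm210_thm211_bdpDisplay_pNew`, SIGN-FREE: `a_p(f) = ±1`
# symbolic) + k5-c4's kernel rescaling `continuousDisplay_pNew_of_bdpDisplay` (sign-free) + Hsieh 2014
# Thm. 1 + the X11b cell's one-sided value rigidity across periods; the SPLIT half of crux 4 at `p ≥ 5`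
# then reads PUBLISHED facts + c3s♭ + «CTL-split ∨ étale switch» + [Mazur's MC on X2b ∩ {split}] (cell
# `bsd-eis`, seat `bsd-eis-cgshw` g9; route `EisensteinPrimes`, crux 4 `BSDpOnCellC` =
# stmt-BirchSwinnertonDyer-19034, line b1 skeleton v5, atom c2 SPLIT conjunct; RULINGS L11 (O2) / L12 (iii)
# / L14; the split twin of k5-c4's `X2/NonsplitCellCClassIntPNew.lean` p436961; THEOREMS ONLY)

HONEST FRAMING (cell `bsd-eis`, run/shared/lean/pub/bsd-eis/): theorems only; nothing booked; X2 stays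
CONSTRUCTION-SHAPED; no label or count moves. `X2/SplitCellCClassIntEtale.lean` (cgshw g8, p434923)
reads the SPLIT half of crux 4 over the wide receptacle as: PUBLISHED facts + c2s♭
`SplitBDPValueOnTreeInt` + c3s♭ `SplitIMCEqOnTreeInt` + «CTL-split ∨ switch» per pair + [Mazur's MC on
X2b ∩ {split}]. At `p ≥ 5` the value half c2s♭ is not needed AS A HYPOTHESIS, for the same reason as on
the ¬split road (k5-c4 g2, RULING L11 (O2)): the Literature fact
`Castella2018Exceptional.thm210_thm211_bdpDisplay_pNew` ([cas-split] = Castella JIMJ 17 Thms. 2.10–2.11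
at weight `2`, `c = 1`, in BDP 2013's own display) is stated for the `p`-NEW newform of `E` with
`a_p(f) = a_p(E)` SYMBOLIC — EITHER sign; the split sign `a_p = +1` is cas-split's MAIN case (§3 there) —
and k5-c4's KERNEL rescaling `continuousDisplay_pNew_of_bdpDisplay` (`X2/NonsplitBDPValueDisplayPNew.lean`)
to the continuous-function display with virtual periods uses no sign either. So at the admissible field
`K` of the (b1) road (odd `d_K < −4`, Heegner for `N_E` — hence `p` split in `K` —, `L(E^{d_K},1) ≠ 0`
by Hoffstein–Luo) the value of Hsieh's ♭-frame at `𝟙` is the printed one by the X11b cell's ONE-SIDED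
VALUE RIGIDITY ACROSS PERIODS (`X11b.intSeries_constantCoeff_eq_of_isBDPLFunctionInt_of_continuousValues`;
`c ≠ 0` by `a_p = ±1` and `log_{ω_E} P ≠ 0` for `P` of infinite order), exactly as in k5-c4's file, and
the sign-free pointwise assembly `bsdp_of_cellC_of_controlOnTreeAt_of_intHalves_of_partner`
(`X2/SplitHalvesOnTreeInt.lean`, p432153) finishes.

* `bsdp_of_cellC_of_split_of_manin_of_pNewValue_of_imcInt_of_ctl` — pointwise at a SPLIT pair carrying a
  Manin datum prime to `p`, `5 ≤ p`: `BSD(E,p)` from PUBLISHED facts (incl. Hsieh 2014 Thm. 1 `hH` and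
  [cas-split] `hCS`), c3s♭ and CTL-split at the pair, and Mazur's MC on X2b ∩ {split} (partner by parity
  cases, as in p432213). NO c1s, NO c2s.
* **`bsdp_of_cellC_of_split_of_pNewValue_of_imcInt_of_ctlOrSwitch`** — CLASS LEVEL, `5 ≤ p`:
  `∀ W p, 5 ≤ p → CellC W p → split → BSDp W p` ⇐ PUBLISHED facts + c3s♭ (at every split CellC pair) +
  «CTL-split ∨ étale switch» per pair (skeleton v5's `stub_ctlOrSwitch` VERBATIM; at the switched curve
  CTL is the THEOREM `splitControlOnTree_of_cellC_of_noPadicPTorsion`, p434550) + Mazur's MC on X2b ∩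
  {split}. NO c1s, NO c2s.
* `bsdp_of_cellC_of_split_of_pNewValue_of_imcInt_of_switch` — the same from the switch input alone.

So at `p ≥ 5` BOTH halves of crux 4 read: PUBLISHED facts (24 named: the 23 of `stub_publishedFacts` +
`thm210_thm211_bdpDisplay_pNew`) + c3 (♭, both signs; Keller–Yin Thm. D shape, PREPRINT) + [crux 3] +
(split only) «CTL ∨ switch»; the value half c2 survives as a typed input ONLY at `p = 3` (5 382 non-split
+ 7 429 split NotGV cells and the GV cells @3: no value theorem at `3 ‖ N` in print; LZZ18 lead,
k5-c4-MEMO-1 (B3)). CONDITIONAL on every listed binder; nothing booked; no label change.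

References: [Castella2018Exceptional] Thms. 2.10–2.11, Prop. 2.7 (arXiv:1507.04260 pp. 13–14);
[Castella2018] Thm. 2.3, Thm. 3.2, (3.2)–(3.3); [Hsieh2014] Thm. 1; [BertoliniDarmonPrasanna2013] §5.2;
[KellerYin2024] Thm. 5.1.3 = Thm. D (PRE); [CastellaEtAl2021] Thm. 5.3.1; [Mazur1978] Cor. 4.1;
[MilneADT2006] Thm. I.7.3; [Miller2011LMS] Def. 1.1; cgshw MEMO-7/10/11, k5-c4 MEMO-1/2.
-/

set_option autoImplicit false

noncomputable section

open scoped Classical MatrixGroups ModularForm Topology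

open Filter CongruenceSubgroup WeierstrassCurve NumberField IsDedekindDomain Field PowerSeries
  Literature.NumberTheory.EllipticCurves Literature.NumberTheory.EllipticCurves.GreenbergSelmer
  Literature.NumberTheory.EllipticCurves.ModularForms Literature.NumberTheory.QuadraticFields
  Literature.NumberTheory.EllipticCurves.Rank1Residual
  Literature.NumberTheory.EllipticCurves.Rank1Residual.Typed
  Literature.NumberTheory.EllipticCurves.KrizLi2019
  Literature.NumberTheory.EllipticCurves.GreenbergVatsal2000
  Literature.NumberTheory.EllipticCurves.Wuthrich2014
  Literature.NumberTheory.EllipticCurves.SteinWuthrich2013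
  Literature.NumberTheory.EllipticCurves.Castella2018
  Literature.NumberTheory.EllipticCurves.Castella2018Exceptional
  Literature.NumberTheory.GaloisRepresentations Literature.NumberTheory.GaloisCohomology
  Literature.NumberTheory.Automorphic
  Summit.BirchSwinnertonDyer.Rank1Residual.X11b.AcSelmer
  Summit.BirchSwinnertonDyer.Rank1Residual.X11b.Halves
  Summit.BirchSwinnertonDyer.Rank1Residual.X11b

namespace Summit.BirchSwinnertonDyer.Rank1Residual.X2

/-! ### Pointwise at `p ≥ 5`: the value half from print at the datum's frame, SPLIT sign -/

section Pointwise

variable (W : WeierstrassCurve ℚ) [W.IsElliptic] [W.IsGloballyMinimal] (p : ℕ) [Fact p.Prime]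

/-- **X2c ∩ {SPLIT}, `p ≥ 5`, pointwise with a Manin datum — c2s FROM PRINT.**
`bsdp_of_cellC_of_split_of_manin_of_intResiduals` (`X2/SplitCellCClassInt.lean`, p432213) with the
hypothesis `h2 : SplitBDPValueOnTreeInt W p` REPLACED by the Literature fact
`thm210_thm211_bdpDisplay_pNew` ([cas-split] Thms. 2.10–2.11 in BDP's display, `p ≥ 5`, `p`-new, `a_p`
symbolic — here `a_p = +1` —, no image hypothesis) and `5 ≤ p`. The datum is produced as there
(Hoffstein–Luo field with ODD `d_K < −4`, Heegner datum, `P` read through `w₀.embedding`, non-torsion by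
Gross–Zagier, Néron twist and transport values, partner `PPartRankZero` by parity cases from `hMCB`,
anticyclotomic `(κ, γ)`, degree-one `𝔭`); the frame is Hsieh's at an embedding datum `ι'` inducing `𝔭`
(`X11b.exists_datum_forall_mem_iff`, `exists_isBDPLFunctionInt_of_hsieh2014_of_classX2`, SIGN-FREE,
`f = Dt.f`); c3s♭ is instantiated at it; its VALUE at `𝟙` is the printed one by k5-c4's
`continuousDisplay_pNew_of_bdpDisplay` and one-sided ♭-V1RIG
(`X11b.intSeries_constantCoeff_eq_of_isBDPLFunctionInt_of_continuousValues`; `c ≠ 0` by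
`X11b.R1.not_dvd_lFunction_of_mult` and `X11b.R1.logOmega_ne_zero`); CTL-split at the datum from `hCTL`;
then the sign-free `bsdp_of_cellC_of_controlOnTreeAt_of_intHalves_of_partner` (p432153). CONDITIONAL on
every listed binder; nothing booked. [cite: Castella2018Exceptional, Thm. 2.10 and Thm. 2.11 (arXiv:1507.04260 pp. 13–14)]
[cite: Hsieh2014, Thm. 1 (arXiv:1112.1580 pp. 3–4)] [claim: KellerYin2024, status: under-review]
[cite: Castella2018, Thm. 2.3 (arXiv:1704.06608 p. 5)] [cite: CastellaEtAl2021, Thm. 5.3.1 and (5.5)–(5.7)]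
[cite: Miller2011LMS, Def. 1.1] -/
theorem bsdp_of_cellC_of_split_of_manin_of_pNewValue_of_imcInt_of_ctl
    (hGV : lambdaMu_multiplicative_of_gvPar) (hWu : thm16_charIdeal_dvd_multiplicative_of_reducible)
    (hJs : thm61_splitMultiplicative) (hJn : thm61_nonsplitMultiplicative)
    (hHs : exists_isSplitMultCanonical) (hHn : exists_isMultCanonical)
    (hpar : nonempty_modularParametrizationData)
    (hGS : ∀ (W : WeierstrassCurve ℚ) [W.IsElliptic] [W.IsGloballyMinimal] (p : ℕ) [Fact p.Prime],
      greenberg_stevens (W := W) (p := p))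
    (hnf : exists_isNewformOf) (hH : hsieh2014_exists_anticyclotomicPAdicLFunction)
    (hCS : thm210_thm211_bdpDisplay_pNew)
    (hGZ : ∀ (N : ℕ) [NeZero N] (W : WeierstrassCurve ℚ) (K : Type) [Field K] [NumberField K],
      gross_zagier N W K)
    (hKo : ∀ (N : ℕ) [NeZero N] (W : WeierstrassCurve ℚ) (K : Type) [Field K] [NumberField K],
      kolyvagin N W K)
    (hHP : ∀ (N : ℕ) [NeZero N] (W : WeierstrassCurve ℚ) (K : Type) [Field K] [NumberField K],
      heegnerPointComplex_mem_range_map N W K)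
    (hGZK : rank_eq_analyticRank_of_analyticRank_le_one)
    (hHL : HoffsteinLuo1997_exists_twist_L_one_ne_zero)
    (hp5 : 5 ≤ p) (hc : CellC W p) (hs : W.HasSplitMultiplicativeReductionAtPrime p)
    (hMan : HasPrimeToManinDatum W p) (h3 : SplitIMCEqOnTreeInt W p) (hCTL : SplitControlOnTree W p)
    (hMCB : ∀ (W' : WeierstrassCurve ℚ) [W'.IsElliptic] [W'.IsGloballyMinimal],
      CellB W' p → W'.HasSplitMultiplicativeReductionAtPrime p → MazurMainConjectureAt W' p) :
    BSDp W p := by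
  have hp : p.Prime := Fact.out
  have hmod : hasEntireLFunction_rat := WeierstrassCurve.hasEntireLFunction_rat_of_exists_isNewformOf hnf
  obtain ⟨hr, hp2, hred, hmult⟩ := hc
  haveI : NeZero (W.conductorNorm ℤ) := ⟨(W.conductorNorm_pos_holds).ne'⟩
  -- `w(E) = -1`
  have hw : W.rootNumber = -1 := by
    rw [WeierstrassCurve.rootNumber_eq_neg_one_pow_analyticRank_of_exists_isNewformOf hnf W, hr]
    norm_num
  -- the admissible auxiliary field (odd `d_K < -4`, Heegner for `N_E`, `L(E^{d_K},1) ≠ 0`)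
  obtain ⟨K, _, _, hK, hodd, hlt, hHN, hHp, hLK⟩ :=
    exists_admissibleField_of_rootNumber_eq_neg_one hnf hHL W hw p
  -- the datum with `p ∤ c`, a Heegner datum and the `K`-rational Heegner point READ THROUGH `w₀`
  obtain ⟨Dt, hcM⟩ := hMan
  obtain ⟨β, hβ⟩ := exists_dvd_sq_sub_discr_holds (W.conductorNorm ℤ) K hK hHN
  obtain ⟨H, -⟩ := nonempty_heegnerDatum_holds (W.conductorNorm ℤ) K hK hβ
  obtain ⟨w₀⟩ := (inferInstance : Nonempty (InfinitePlace K))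
  obtain ⟨P, hP⟩ := hHP (W.conductorNorm ℤ) W K hK hHN Dt H w₀.embedding
  -- the Heegner point has infinite order: `L'(E/K,1) = L'(E,1)·L(E^K,1) ≠ 0` (Gross–Zagier)
  have hL0 : W.entireLFunction 1 = 0 := entireLFunction_one_eq_zero_of_analyticRank_eq_one hr
  obtain ⟨-, hderiv⟩ := leadingLCoeff_eq_deriv_of_analyticRank_eq_one hr
  have hLKd : LDerivEK W K ≠ 0 := by
    rw [lDerivEK_eq_deriv_mul W K hmod hL0]
    exact mul_ne_zero hderiv hLK
  have hPH : IsHeegnerPoint (W.conductorNorm ℤ) W K P := ⟨Dt, H, w₀.embedding, hP⟩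
  have hPinf : ¬ IsOfFinAddOrder P :=
    (lDerivEK_ne_zero_iff_not_isOfFinAddOrder W (W.conductorNorm ℤ) K (hGZ _ W K) hK hHN hPH).mp hLKd
  -- a globally minimal model of the twist (Néron) and its transport values
  have hD0 : (NumberField.discr K : ℚ) ≠ 0 := by exact_mod_cast NumberField.discr_ne_zero K
  haveI hEt : (W.quadraticTwist (NumberField.discr K : ℚ)).IsElliptic :=
    W.isElliptic_quadraticTwist hD0
  obtain ⟨Cd, hCd⟩ := hasGlobalMinimalModel_rat_holds (W.quadraticTwist (NumberField.discr K : ℚ))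
  set Wd : WeierstrassCurve ℚ := Cd • W.quadraticTwist (NumberField.discr K : ℚ) with hWd_def
  haveI : Wd.IsGloballyMinimal := hCd
  have hWd : Cd • W.quadraticTwist (NumberField.discr K : ℚ) = Wd := rfl
  have hC : Cd⁻¹ • Wd = W.quadraticTwist (NumberField.discr K : ℚ) := by
    rw [← hWd, inv_smul_smul]
  obtain ⟨htam, hu⟩ := twistTransportPackage_holds W p K Wd Cd ⟨hr, hp2, hred, hmult⟩ hK hodd hHN hWd
  have htamK : padicValNat p (W.baseChange K).tamagawaProduct = 2 * padicValNat p W.tamagawaProduct :=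
    padicValNat_tamagawaProduct_baseChange_of_heegner_odd W p hp2 K hK hodd hHN hHp
  -- the twist: analytic rank `0`, X2, SPLIT at `p`; its rank-zero `p`-part by parity cases
  have hLd : Wd.entireLFunction 1 ≠ 0 := by
    rw [← hWd, entireLFunction_smul]; exact hLK
  have hrd : Wd.analyticRank = 0 := (Wd.analyticRank_eq_zero_iff_holds (hmod _)).2 hLd
  have hXd : ClassX2 Wd p := classX2_twist W p ⟨hp2, hred, hmult⟩ K hK hHp Wd ⟨Cd⁻¹, hC⟩
  have hsd : Wd.HasSplitMultiplicativeReductionAtPrime p :=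
    (hasSplitMultiplicativeReductionAtPrime_iff_of_smul_eq_quadraticTwist W Wd hK p hp2 hmult hHp
      hC).mpr hs
  have hbsdd : BSDp Wd p := by
    by_cases hgv : GVPar Wd p
    · exact targetA_of_published hGV hWu hJs hJn hHs hHn hGZK hmod hpar hGS Wd p ⟨hrd, hXd, hgv⟩
    · exact bsdp_of_mazurMainConjectureAt_of_analyticRank_eq_zero hJs hJn hHs hHn hGZK hmod hpar Wd p
        (hGS Wd p) hXd.1 hXd.2.2 hrd (hMCB Wd ⟨hrd, hXd, hgv⟩ hsd)
  have htw : PPartRankZero Wd p :=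
    pPartRankZero_of_pPart hGZK Wd p hrd (pPart_of_bsdp hmod hGZK Wd p (by omega) hbsdd)
  -- the anticyclotomic `ℤ_p`-extension, a topological generator, a degree-one prime above `p`
  haveI : IsTotallyComplex K := hK.2
  obtain ⟨κ, hκ⟩ := ZpExtension.exists_isAnticyclotomic_holds (K := K) (p := p) hK.1
    (fun w ↦ IsTotallyComplex.isComplex w)
  obtain ⟨γ, hγ⟩ := κ.surjective (Multiplicative.ofAdd 1)
  haveI : Fact (κ.IsTopGenerator γ) := ⟨hγ⟩
  have hpN : p ∣ W.conductorNorm ℤ := X11b.dvd_conductorNorm_of_mult (W := W) hmult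
  have hp2N : ¬ p ^ 2 ∣ W.conductorNorm ℤ := not_sq_dvd_conductorNorm_of_mult W p hmult
  obtain ⟨𝔭, h𝔭, he, hf⟩ := X11b.exists_degreeOnePrime_of_splitsIn K p hK.1 (hHp p hp dvd_rfl)
  -- an embedding datum inducing `𝔭`, Hsieh's ♭-frame there (for the newform `Dt.f`), c3s♭ at it
  obtain ⟨ι₀⟩ := PadicAlgCl.nonempty_ringEquiv_complex p
  obtain ⟨ι', -, hι'⟩ := X11b.exists_datum_forall_mem_iff p ι₀ hK h𝔭
  obtain ⟨ΩK', Ωp', Q, hΩK', hΩp', hQ⟩ := exists_isBDPLFunctionInt_of_hsieh2014_of_classX2 W p hH ι' 𝔭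
    κ γ Dt.isNewformOf ⟨hp2, hred, hmult⟩ rfl hK hHN h𝔭 hι' hκ hγ
  have hΩp0' : Ωp' ≠ 0 := fun h0 ↦ by rw [h0, norm_zero] at hΩp'; exact zero_ne_one hΩp'
  have h3Q : R1.IMCEqIntAt W p κ 𝔭 γ Q :=
    h3 (W.conductorNorm ℤ) K Dt H w₀.embedding P ⟨hr, hp2, hred, hmult⟩ hs rfl hK hlt hHN hLK hP
      hcM hPinf κ hκ γ 𝔭 h𝔭 he hf Dt.f Dt.isNewformOf ι' hι' ΩK' Ωp' Q hΩK' hΩp' hQ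
  -- the value at `𝟙` of `Q` from print: continuity display + one-sided value rigidity
  have hemb : ∀ k : 𝓞 K, k ∈ 𝔭.asIdeal ↔ ‖embAt K p 𝔭 h𝔭 he hf (k : K)‖ < 1 :=
    mem_asIdeal_iff_norm_embAt_lt_one 𝔭 h𝔭 he hf
  obtain ⟨ΩK₀, Ωp₀, u₀, hΩK₀, hΩp₀, hu₀, hcont⟩ := continuousDisplay_pNew_of_bdpDisplay hCS ι' W K 𝔭 κ γ
    Dt H w₀ (embAt K p 𝔭 h𝔭 he hf)
    P hp5 rfl hpN hp2N hK hodd (hHN p hp hpN) h𝔭 hι' hHN hκ hγ hcM hP hemb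
  have ha : ¬ (p : ℤ) ∣ W.LFunction p := X11b.R1.not_dvd_lFunction_of_mult Dt.isNewformOf hmult
  have hX : algebraMap ℚ_[p] ℂ_[p] (((1 : ℚ_[p]) - ((W.LFunction p : ℤ) : ℚ_[p]) * (p : ℚ_[p])⁻¹) *
      padicLogOmega W p (embAt K p 𝔭 h𝔭 he hf) P) ≠ 0 := by
    rw [map_ne_zero_iff _ (algebraMap ℚ_[p] ℂ_[p]).injective]
    refine mul_ne_zero ?_ ?_
    · intro h0
      have h := X11b.R1.norm_one_sub_div_eq p ha
      rw [h0, norm_zero] at h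
      have hp0 : (0 : ℝ) < p := by exact_mod_cast hp.pos
      exact absurd h (ne_of_lt hp0)
    · rw [← X11b.R1.logOmega_eq_padicLogOmega]
      exact X11b.R1.logOmega_ne_zero W p _ hPinf
  have hu₀0 : u₀ ≠ 0 := fun h0 ↦ by rw [h0, norm_zero] at hu₀; exact zero_ne_one hu₀
  have hc0 : u₀ * (algebraMap ℚ_[p] ℂ_[p] (((1 : ℚ_[p]) - ((W.LFunction p : ℤ) : ℚ_[p]) *
      (p : ℚ_[p])⁻¹) * padicLogOmega W p (embAt K p 𝔭 h𝔭 he hf) P)) ^ 2 ≠ 0 :=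
    mul_ne_zero hu₀0 (pow_ne_zero _ hX)
  have heq := X11b.intSeries_constantCoeff_eq_of_isBDPLFunctionInt_of_continuousValues hp2 hK hκ hγ
    hΩK₀ hΩK' hΩp₀ hΩp0' hcont hc0 hQ
  have h2Q : R1.BDPValueAtOneIntAt W p (embAt K p 𝔭 h𝔭 he hf) P Q (W.LFunction p) := by
    refine ⟨u₀, hu₀, ?_⟩
    rw [X11b.R1.logOmega_eq_padicLogOmega, ← heq]
    exact X11b.R1.intSeries_hasValueAt_zero p Q
  -- CTL-split at the datum, then the sign-free pointwise assembly over the wide receptacle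
  have hCTLd : ControlOnTreeAt p κ 𝔭 γ (embAt K p 𝔭 h𝔭 he hf) P :=
    hCTL K P ⟨hr, hp2, hred, hmult⟩ hs hK hHp hLK hPinf κ hκ γ 𝔭 h𝔭 he hf
  exact bsdp_of_cellC_of_controlOnTreeAt_of_intHalves_of_partner W p hnf (W.conductorNorm ℤ) K Dt H
    w₀.embedding P (hGZ _ W K) (hKo _ W K) hGZK ⟨hr, hp2, hred, hmult⟩ rfl hK hlt hHN hP hcM hLK Wd Cd
    hWd htw htam hu htamK κ 𝔭 γ h𝔭 he hf hCTLd Q h3Q h2Q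

end Pointwise

/-! ### Class level at `p ≥ 5`: PUBLISHED facts + c3s♭ + «CTL ∨ switch» + [Mazur's MC on X2b ∩ {split}] -/

section ClassLevel

/-- **X2c ∩ {SPLIT} ⇒ `BSD(E,p)` at `p ≥ 5`, CLASS LEVEL, with the ÉTALE-ISOGENY SWITCH and the value
half c2s FROM PRINT — NO c1s, NO c2s, NO CTL-split input.** `bsdp_of_cellC_of_split_of_intResiduals_of_switch`
(`X2/SplitCellCClassIntEtale.lean`, p434923) with `h2` REPLACED by `thm210_thm211_bdpDisplay_pNew` and
`5 ≤ p`: every split CellC pair has an isogenous globally minimal `W′` with a Manin datum prime to `p`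
and `W′(ℚ_p)[p] = 0` (`hsw`); CellC and the split type pass to `W′`; CTL-split at `W′` is the THEOREM
`splitControlOnTree_of_cellC_of_noPadicPTorsion` (p434550); the pointwise road above at `W′`; back to `W`
by Cassels. CONDITIONAL on every listed binder; nothing booked; no label change.
[cite: Castella2018Exceptional, Thm. 2.10 and Thm. 2.11 (arXiv:1507.04260 pp. 13–14)]
[cite: Castella2018, Thm. 2.3 (arXiv:1704.06608 p. 5)] [cite: MilneADT2006, Thm. I.7.3]
[cite: Hsieh2014, Thm. 1 (arXiv:1112.1580 pp. 3–4)] [claim: KellerYin2024, status: under-review]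
[cite: Miller2011LMS, Def. 1.1] -/
theorem bsdp_of_cellC_of_split_of_pNewValue_of_imcInt_of_switch
    (hGV : lambdaMu_multiplicative_of_gvPar) (hWu : thm16_charIdeal_dvd_multiplicative_of_reducible)
    (hJs : thm61_splitMultiplicative) (hJn : thm61_nonsplitMultiplicative)
    (hHs : exists_isSplitMultCanonical) (hHn : exists_isMultCanonical)
    (hpar : nonempty_modularParametrizationData)
    (hGS : ∀ (W : WeierstrassCurve ℚ) [W.IsElliptic] [W.IsGloballyMinimal] (p : ℕ) [Fact p.Prime],
      greenberg_stevens (W := W) (p := p))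
    (hnf : exists_isNewformOf)
    (hPT : ∀ (K : Type) [Field K] [NumberField K], poitouTate_selmerStructure_duality K)
    (hPT2 : ∀ (K : Type) [Field K] [NumberField K], poitouTate_sha_tateDual K)
    (hEP : ∀ (K : Type) [Field K] [NumberField K] (v : HeightOneSpectrum (𝓞 K)),
      localEulerPoincareCharacteristic (v.adicCompletion K))
    (hcd : fieldCdLE_two_of_numberField)
    (hBr : ∀ (K : Type) [Field K] [NumberField K] (p : ℕ) [Fact p.Prime],
      ZpExtension.decomp_not_le_kerSubgroup_of_isAnticyclotomic K p)
    (hH : hsieh2014_exists_anticyclotomicPAdicLFunction)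
    (hCS : thm210_thm211_bdpDisplay_pNew)
    (hGZ : ∀ (N : ℕ) [NeZero N] (W : WeierstrassCurve ℚ) (K : Type) [Field K] [NumberField K],
      gross_zagier N W K)
    (hKo : ∀ (N : ℕ) [NeZero N] (W : WeierstrassCurve ℚ) (K : Type) [Field K] [NumberField K],
      kolyvagin N W K)
    (hHP : ∀ (N : ℕ) [NeZero N] (W : WeierstrassCurve ℚ) (K : Type) [Field K] [NumberField K],
      heegnerPointComplex_mem_range_map N W K)
    (hGZK : rank_eq_analyticRank_of_analyticRank_le_one)
    (hHL : HoffsteinLuo1997_exists_twist_L_one_ne_zero)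
    (hCassels : bsdRHS_eq_of_isIsogenous)
    (h3 : ∀ (W : WeierstrassCurve ℚ) [W.IsElliptic] [W.IsGloballyMinimal] (p : ℕ) [Fact p.Prime],
      CellC W p → W.HasSplitMultiplicativeReductionAtPrime p → SplitIMCEqOnTreeInt W p)
    (hsw : ∀ (W : WeierstrassCurve ℚ) [W.IsElliptic] [W.IsGloballyMinimal] (p : ℕ) [Fact p.Prime],
      CellC W p → W.HasSplitMultiplicativeReductionAtPrime p →
        ∃ (W' : WeierstrassCurve ℚ) (_ : W'.IsElliptic) (_ : W'.IsGloballyMinimal),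
          IsIsogenous W W' ∧ HasPrimeToManinDatum W' p ∧
            ∀ Q₀ : (W'.baseChange ℚ_[p]).toAffine.Point, p • Q₀ = 0 → Q₀ = 0)
    (hMCB : ∀ (W : WeierstrassCurve ℚ) [W.IsElliptic] [W.IsGloballyMinimal] (p : ℕ) [Fact p.Prime],
      CellB W p → W.HasSplitMultiplicativeReductionAtPrime p → MazurMainConjectureAt W p)
    (W : WeierstrassCurve ℚ) [W.IsElliptic] [W.IsGloballyMinimal] (p : ℕ) [Fact p.Prime]
    (hp5 : 5 ≤ p) (hc : CellC W p) (hs : W.HasSplitMultiplicativeReductionAtPrime p) : BSDp W p := by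
  obtain ⟨W', _, _, hiso, hMan', h0'⟩ := hsw W p hc hs
  have hc' : CellC W' p := CellC.of_isIsogenous hiso hc
  have hs' : W'.HasSplitMultiplicativeReductionAtPrime p :=
    IsogenyQuotientLine.hasSplitMultiplicativeReductionAtPrime_of_isIsogenous hiso hs
  have hCTL' : SplitControlOnTree W' p :=
    splitControlOnTree_of_cellC_of_noPadicPTorsion W' p hGZK hnf hPT hPT2 hEP hcd hBr hc' h0'
  have hb' : BSDp W' p :=
    bsdp_of_cellC_of_split_of_manin_of_pNewValue_of_imcInt_of_ctl W' p hGV hWu hJs hJn hHs hHn hpar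
      hGS hnf hH hCS hGZ hKo hHP hGZK hHL hp5 hc' hs' hMan' (h3 W' p hc' hs') hCTL'
      (fun W'' _ _ hB hs'' ↦ hMCB W'' p hB hs'')
  have hmod : hasEntireLFunction_rat := hasEntireLFunction_rat_of_exists_isNewformOf hnf
  exact bsdp_of_isIsogenous_of_bsdp hCassels hGZK hmod W' W hiso.symm_of_charZero p (by rw [hc'.1]) hb'

/-- **X2c ∩ {SPLIT} ⇒ `BSD(E,p)` at `p ≥ 5`, CLASS LEVEL, from «CTL-split OR the switch» per pair and
the value half c2s FROM PRINT — NO c1s, NO c2s** — line b1 skeleton v5's split branch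
(`bsdp_of_cellC_of_split_of_intResiduals_of_ctlOrSwitch`, p434923) with `h2` REPLACED by
`thm210_thm211_bdpDisplay_pNew` and `5 ≤ p`; `hcs` is `stub_ctlOrSwitch` VERBATIM. Proof: move to the
`X₀(N)`-optimal curve `W₀ ∼ W` (`bsdp_of_cellC_of_forall_isIsogenous`: Edixhoven, Mazur, Cassels); at
`W₀` case on the disjunction: CTL ⟹ the pointwise theorem at `W₀`; switch `W′ ∼ W₀` ⟹ the same at
`W′` with CTL the THEOREM `splitControlOnTree_of_cellC_of_noPadicPTorsion`, then Cassels `W′ → W₀`.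
CONDITIONAL on every listed binder; nothing booked; X2 CONSTRUCTION-SHAPED; no label change.
[cite: Castella2018Exceptional, Thm. 2.10 and Thm. 2.11 (arXiv:1507.04260 pp. 13–14)]
[cite: CastellaEtAl2021, Thm. 5.3.1] [cite: Mazur1978, Cor. 4.1] [cite: MilneADT2006, Thm. I.7.3]
[cite: Castella2018, Thm. 2.3 (arXiv:1704.06608 p. 5)] [cite: Hsieh2014, Thm. 1 (arXiv:1112.1580 pp. 3–4)]
[claim: KellerYin2024, status: under-review] [cite: Miller2011LMS, Def. 1.1] -/
theorem bsdp_of_cellC_of_split_of_pNewValue_of_imcInt_of_ctlOrSwitch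
    (hGV : lambdaMu_multiplicative_of_gvPar) (hWu : thm16_charIdeal_dvd_multiplicative_of_reducible)
    (hJs : thm61_splitMultiplicative) (hJn : thm61_nonsplitMultiplicative)
    (hHs : exists_isSplitMultCanonical) (hHn : exists_isMultCanonical)
    (hpar : nonempty_modularParametrizationData)
    (hGS : ∀ (W : WeierstrassCurve ℚ) [W.IsElliptic] [W.IsGloballyMinimal] (p : ℕ) [Fact p.Prime],
      greenberg_stevens (W := W) (p := p))
    (hnf : exists_isNewformOf)
    (hPT : ∀ (K : Type) [Field K] [NumberField K], poitouTate_selmerStructure_duality K)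
    (hPT2 : ∀ (K : Type) [Field K] [NumberField K], poitouTate_sha_tateDual K)
    (hEP : ∀ (K : Type) [Field K] [NumberField K] (v : HeightOneSpectrum (𝓞 K)),
      localEulerPoincareCharacteristic (v.adicCompletion K))
    (hcd : fieldCdLE_two_of_numberField)
    (hBr : ∀ (K : Type) [Field K] [NumberField K] (p : ℕ) [Fact p.Prime],
      ZpExtension.decomp_not_le_kerSubgroup_of_isAnticyclotomic K p)
    (hH : hsieh2014_exists_anticyclotomicPAdicLFunction)
    (hCS : thm210_thm211_bdpDisplay_pNew)
    (hGZ : ∀ (N : ℕ) [NeZero N] (W : WeierstrassCurve ℚ) (K : Type) [Field K] [NumberField K],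
      gross_zagier N W K)
    (hKo : ∀ (N : ℕ) [NeZero N] (W : WeierstrassCurve ℚ) (K : Type) [Field K] [NumberField K],
      kolyvagin N W K)
    (hHP : ∀ (N : ℕ) [NeZero N] (W : WeierstrassCurve ℚ) (K : Type) [Field K] [NumberField K],
      heegnerPointComplex_mem_range_map N W K)
    (hGZK : rank_eq_analyticRank_of_analyticRank_le_one)
    (hHL : HoffsteinLuo1997_exists_twist_L_one_ne_zero)
    (hEd : edixhoven_optimalManinConstant_integral) (hMaz : mazur_not_dvd_maninConstant_of_odd)
    (hCassels : bsdRHS_eq_of_isIsogenous)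
    (h3 : ∀ (W : WeierstrassCurve ℚ) [W.IsElliptic] [W.IsGloballyMinimal] (p : ℕ) [Fact p.Prime],
      CellC W p → W.HasSplitMultiplicativeReductionAtPrime p → SplitIMCEqOnTreeInt W p)
    (hcs : ∀ (W : WeierstrassCurve ℚ) [W.IsElliptic] [W.IsGloballyMinimal] (p : ℕ) [Fact p.Prime],
      CellC W p → W.HasSplitMultiplicativeReductionAtPrime p →
        SplitControlOnTree W p ∨
          ∃ (W' : WeierstrassCurve ℚ) (_ : W'.IsElliptic) (_ : W'.IsGloballyMinimal),
            IsIsogenous W W' ∧ HasPrimeToManinDatum W' p ∧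
              ∀ Q₀ : (W'.baseChange ℚ_[p]).toAffine.Point, p • Q₀ = 0 → Q₀ = 0)
    (hMCB : ∀ (W : WeierstrassCurve ℚ) [W.IsElliptic] [W.IsGloballyMinimal] (p : ℕ) [Fact p.Prime],
      CellB W p → W.HasSplitMultiplicativeReductionAtPrime p → MazurMainConjectureAt W p)
    (W : WeierstrassCurve ℚ) [W.IsElliptic] [W.IsGloballyMinimal] (p : ℕ) [Fact p.Prime]
    (hp5 : 5 ≤ p) (hc : CellC W p) (hs : W.HasSplitMultiplicativeReductionAtPrime p) : BSDp W p := by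
  have hmod : hasEntireLFunction_rat := hasEntireLFunction_rat_of_exists_isNewformOf hnf
  refine bsdp_of_cellC_of_forall_isIsogenous hEd hMaz hCassels hpar hnf hGZK W p hc ?_
  intro W₀ _ _ hiso hc₀ hMan₀
  have hs₀ : W₀.HasSplitMultiplicativeReductionAtPrime p :=
    IsogenyQuotientLine.hasSplitMultiplicativeReductionAtPrime_of_isIsogenous hiso hs
  rcases hcs W₀ p hc₀ hs₀ with hCTL₀ | ⟨W', _, _, hiso', hMan', h0'⟩
  · exact bsdp_of_cellC_of_split_of_manin_of_pNewValue_of_imcInt_of_ctl W₀ p hGV hWu hJs hJn hHs hHn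
      hpar hGS hnf hH hCS hGZ hKo hHP hGZK hHL hp5 hc₀ hs₀ hMan₀ (h3 W₀ p hc₀ hs₀) hCTL₀
      (fun W'' _ _ hB hs'' ↦ hMCB W'' p hB hs'')
  · have hc' : CellC W' p := CellC.of_isIsogenous hiso' hc₀
    have hs' : W'.HasSplitMultiplicativeReductionAtPrime p :=
      IsogenyQuotientLine.hasSplitMultiplicativeReductionAtPrime_of_isIsogenous hiso' hs₀
    have hCTL' : SplitControlOnTree W' p :=
      splitControlOnTree_of_cellC_of_noPadicPTorsion W' p hGZK hnf hPT hPT2 hEP hcd hBr hc' h0'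
    have hb' : BSDp W' p :=
      bsdp_of_cellC_of_split_of_manin_of_pNewValue_of_imcInt_of_ctl W' p hGV hWu hJs hJn hHs hHn hpar
        hGS hnf hH hCS hGZ hKo hHP hGZK hHL hp5 hc' hs' hMan' (h3 W' p hc' hs') hCTL'
        (fun W'' _ _ hB hs'' ↦ hMCB W'' p hB hs'')
    exact bsdp_of_isIsogenous_of_bsdp hCassels hGZK hmod W' W₀ hiso'.symm_of_charZero p (by rw [hc'.1])
      hb'

end ClassLevel

end Summit.BirchSwinnertonDyer.Rank1Residual.X2

end
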